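import Summits.RiemannHypothesis.RiemannHypothesis.Theorems.Splittings.LinearRayLehmerWindowDefs

/-!
# The linear-factor ray at Lehmer's pair — compiled certificate 2/3: forward averages, `1 ≤ a ≤ 4`

Cell rh-split (D-0116 arm), ENGINE 5 (rh-splitx-eng-5 g4), lane (xviii-D) «LEHMER WINDOW DATA».
The forward-average check `ldQRun 10 50 ldAsLow 1000 9 250 219000`: the engine's forward point data
(`hiPointData C 10 0 50`: 50 Gauss–Legendre cells of half-width `1/10` after `t₀`, 800 certified `ζ`
evaluations, no backward cells), boxes `ldAsLow/1000 = [1, 5/4, 3/2, 2, 5/2, 3, 7/2, 4]`, and per box the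
margin `(9/250)·219000 < e^{−a₂·9/250}·q` — evaluated ONCE by `native_decide` (declared computational axiom
`ldLow_check`).  Design numbers: `q = 4.4·10⁷ … 3.4·10⁶` (`K₀`-free units) against `L·M = 7884`.
Soundness: `ldQRunWith_sound` (file `LinearRayLehmerWindowQ.lean`).
HONEST LABEL: RH-free negative-side bookkeeping on the linear-factor ray; nothing here bears on the truth of RH.
-/

set_option linter.dupNamespace false

namespace Summit.RiemannHypothesis.RiemannHypothesis.Theorems.Splittings.LinearRayLehmerWindow

/-- **The compiled forward-average check, low window** (`native_decide`). [folklore] -/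
theorem ldLow_check : ldQRun 10 50 ldAsLow 1000 9 250 219000 = true := by
  native_decide

end Summit.RiemannHypothesis.RiemannHypothesis.Theorems.Splittings.LinearRayLehmerWindow
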